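import Mathlib
import Literature.LinearAlgebra.Matrix.FixedRankTangentSpace

/-!
# The projector-splitting integrator for dynamical low-rank approximation and its exactness property (Lubich–Oseledets)

Lubich–Oseledets, *A projector-splitting integrator for dynamical low-rank approximation*, BIT 54
(2014) 171–188 [cite: LubichOseledets2013, §2; §3.1 Lemma 3.1; §3.2; §4 Thm 4.1]
(arXiv:1301.1058).  The matrix `KSL` scheme underlying the TT/MPS time integrators (its tensor-train
version is Lubich–Oseledets–Vandereycken 2015, whose tangent-space projector is
`TensorTrainTangentProjector.lean`).

§2: «the approximation `Y(t) ∈ M_r` is represented in a non-unique way as `Y(t) = U(t) S(t) V(t)ᵀ`,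
where `U(t) ∈ ℝ^{m×r}` and `V(t) ∈ ℝ^{n×r}` each have `r` orthonormal columns, and `S(t) ∈ ℝ^{r×r}`
… `Ẏ(t) = P(Y(t)) Ȧ(t)`, where `P(Y)` is the orthogonal projector onto the tangent space `T_Y M_r`
… The projector has a simple representation [KocL07]: for `Y = U S Vᵀ` as in (2.1),
`P(Y) Z = Z V Vᵀ - U Uᵀ Z V Vᵀ + U Uᵀ Z`.»  [equation labels of the journal version are not
reproduced here; “(2.1)” is the paper's own back-reference to the factorization `Y = U S Vᵀ`]

§3.1 (Lie–Trotter splitting of the projector formula into its three terms, substeps 1.–3.), proof of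
Lemma 3.1: «each of the terms on the right-hand side of [the projector formula] is in the tangent space `T_Y M_r`, because for
the first term the orthonormality `Vᵀ V = I` yields
`P(Y)(Z V Vᵀ) = Z V Vᵀ + U Uᵀ Z V Vᵀ - U Uᵀ Z V Vᵀ = Z V Vᵀ`, so that `Z V Vᵀ ∈ T_Y M_r`.  Similarly
we also have `U Uᵀ Z ∈ T_Y M_r` and `U Uᵀ Z V Vᵀ ∈ T_Y M_r`.»

§3.2 «First-order splitting method, practical algorithm.  … Given a factorization (2.1) of the
rank-`r` matrix `Y_0 = U_0 S_0 V_0ᵀ` and denoting the increment `ΔA = A(t_1) - A(t_0)`, one step of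
the integrator reads as follows: 1. Set `K_1 = U_0 S_0 + ΔA V_0` and compute the factorization
`U_1 Ŝ_1 = K_1` with `U_1` having orthonormal columns and an `r × r` matrix `Ŝ_1` (using QR or
SVD).  2. Set `S̃_0 = Ŝ_1 - U_1ᵀ ΔA V_0`.  3. Set `L_1 = V_0 S̃_0ᵀ + ΔAᵀ U_1` and compute the
factorization `V_1 S_1ᵀ = L_1`, with `V_1` having orthonormal columns and an `r × r` matrix `S_1`
(using QR or SVD).  The algorithm computes a factorization of the rank-`r` matrix `Y_1 = U_1 S_1 V_1ᵀ`,
which is taken as an approximation to `Y(t_1)`.»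

§4: «The following result depends on the ordering of the splitting of the projector, so that
we first compute `K = U S`, then `S`, then `L = V Sᵀ`.  For a different ordering, such as computing
subsequently `K`, `L`, `S`, the following surprising exactness result is not valid.
THEOREM 4.1.  Suppose that `A(t)` has rank at most `r` for all `t`.  With the initial value
`Y_0 = A(t_0)`, the splitting algorithm of Section 3.2 is then exact: `Y_1 = A(t_1)`.
Proof.  We decompose `A(t) = U(t) S(t) V(t)ᵀ`, where both `U(t)` and `V(t)` have `r` orthonormal
columns, and `S(t)` is an `r × r` matrix.  We assume that `V(t_1)ᵀ V(t_0)` is invertible.  If this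
is not satisfied, then we make the following argument with a small perturbation of `A(t_1)` such
that `V(t_1)ᵀ V(t_0)` becomes invertible, and let the perturbation tend to zero in the end.  The
first substep of the algorithm, starting from `Y_0 = U_0 S_0 V_0ᵀ = U(t_0) S(t_0) V(t_0)ᵀ = A(t_0)`,
yields `U_1 Ŝ_1 = A(t_1) V_0 = U(t_1) S(t_1) (V(t_1)ᵀ V(t_0))`, so that the range of
`A_1 = A(t_1) = … = U_1 Ŝ_1 (V(t_1)ᵀ V(t_0))⁻¹ V(t_1)ᵀ` is contained in the range of `U_1`, and hence
we have `U_1 U_1ᵀ A_1 = A_1`, as well as `A_0 V_0 V_0ᵀ = A_0`.  Using the formulas of the splitting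
scheme we then calculate `Y_1 = U_1 S_1 V_1ᵀ = U_1 S̃_0 V_0ᵀ + U_1 U_1ᵀ ΔA
= U_1 Ŝ_1 V_0ᵀ - U_1 U_1ᵀ ΔA V_0 V_0ᵀ + U_1 U_1ᵀ ΔA
= U_0 S_0 V_0ᵀ + ΔA V_0 V_0ᵀ - U_1 U_1ᵀ ΔA V_0 V_0ᵀ + U_1 U_1ᵀ ΔA
= A_0 + A_1 V_0 V_0ᵀ - A_0 - A_1 V_0 V_0ᵀ + U_1 U_1ᵀ A_0 + A_1 - U_1 U_1ᵀ A_0 = A_1`,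
which is the stated result.»

## What is recorded

Matrices over a field `F` with formal orthonormality `Uᵀ U = 1` (as in `FixedRankTangentSpace.lean`,
whose `FixedRank.tangentProj U V` is `P(Y)` and `FixedRank.tangentSpace U V` is `T_Y M_r` in the
`(G, H) = (U S, V)` / `(U, V S ᵀ)` formats):

* §1 — the projector formula in splitting order (`tangentProj_eq_split`) and the three tangent-space facts of the
  proof of Lemma 3.1 (`tangentProj_mul_projRight`, `mul_projRight_mem_tangentSpace`,
  `projLeft_mul_mem_tangentSpace`, `projLeft_mul_mul_projRight_mem_tangentSpace`,
  `tangentProj_projLeft_mul`);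
* §2 — the three steps of the practical algorithm as matrix functions `kStep` (`K_1`), `sStep`
  (`S̃_0`), `lStep` (`L_1`); the factorizations `U_1 Ŝ_1 = K_1`, `V_1 S_1ᵀ = L_1` enter as
  hypotheses (`hK`, `hL`) on otherwise arbitrary `U_1, Ŝ_1, V_1, S_1` — any QR/SVD choice; the
  first lines of the computation, valid for every step: `Y_1 = U_1 S̃_0 V_0ᵀ + U_1 U_1ᵀ ΔA`
  (`result_eq_of_lFac`) and `Y_1 = U_0 S_0 V_0ᵀ + ΔA V_0 V_0ᵀ - U_1 U_1ᵀ ΔA V_0 V_0ᵀ + U_1 U_1ᵀ ΔA`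
  (`result_eq_expand`); from exact data `Y_0 = A_0`: `K_1 = A_1 V_0` (`kStep_eq_mul_of_start`);
* §3 — THEOREM 4.1: `A_0 V_0 V_0ᵀ = A_0` (`start_mul_projRight`); the computation up to its last
  substitution, `Y_1 = U_1 U_1ᵀ A_1` (`result_eq_projLeft_mul`, so the step is exact precisely when
  the range of `A_1` lies in the range of `U_1`, `exactness_of_projLeft_mul_eq`); the range
  statement `U_1 U_1ᵀ A_1 = A_1` from the `K`-step under the paper's standing assumption, taken in
  the intrinsic form `rank (A_1 V_0) = rank A_1` (`projLeft_mul_eq_self_of_rank_eq`; the paper's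
  "`V(t_1)ᵀ V(t_0)` invertible" implies it, `rank_mul_eq_rank_of_isUnit_det`); and the theorem
  (`exactness`, `exactness_of_isUnit_det`).

Honest scope.  Theorem 4.1 is recorded under the standing assumption of its proof ("`V(t_1)ᵀ V(t_0)`
is invertible", resp. `rank (A_1 V_0) = rank A_1`); the limiting argument offered for the
degenerate case is not formalised (in that case `K_1 = A_1 V_0` is rank deficient and the
orthonormal factor `U_1` is not determined by `K_1`; what is recorded unconditionally is
`Y_1 = U_1 U_1ᵀ A_1`).  Not treated: the differential equations of §3.1 and their closed-form
solutions (Lemma 3.1 proper), the equivalence of §3.2 with the abstract splitting, the symmetric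
second-order composition of §3.3, §3.4, the robustness Theorem 4.2 and everything after §4.
This formalisation is AI-produced.
-/

noncomputable section

namespace Literature.LinearAlgebra.Matrix

namespace ProjectorSplitting

open _root_.Matrix Function FixedRank

variable {m n r : Type*} {F : Type*} [Field F] [Fintype r]

/-! ## §1. The tangent-space projector in the splitting order `K, S, L` -/

/-- THE PROJECTOR IN SPLITTING ORDER: "The projector has a simple representation [KocL07]: for
`Y = U S Vᵀ` as in (2.1), `P(Y) Z = Z V Vᵀ - U Uᵀ Z V Vᵀ + U Uᵀ Z`" (the three terms, in this
order, are the right-hand sides of the substeps 1.–3. of §3.1).  Here `P(Y)` is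
`FixedRank.tangentProj U V` of `FixedRankTangentSpace.lean`.
[cite: LubichOseledets2013, §2] -/
theorem tangentProj_eq_split [Fintype m] [Fintype n] (U : Matrix m r F) (V : Matrix n r F) (Z : Matrix m n F) :
    tangentProj U V Z = Z * (V * Vᵀ) - U * Uᵀ * Z * (V * Vᵀ) + U * Uᵀ * Z := by
  rw [tangentProj_apply]
  abel

/-- "for the first term the orthonormality `Vᵀ V = I` yields
`P(Y)(Z V Vᵀ) = Z V Vᵀ + U Uᵀ Z V Vᵀ - U Uᵀ Z V Vᵀ = Z V Vᵀ`" (proof of Lemma 3.1).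
[cite: LubichOseledets2013, §3.1 Lemma 3.1 (proof)] -/
theorem tangentProj_mul_projRight [Fintype m] [Fintype n] [DecidableEq r] (U : Matrix m r F) {V : Matrix n r F}
    (hV : Vᵀ * V = 1) (Z : Matrix m n F) :
    tangentProj U V (Z * (V * Vᵀ)) = Z * (V * Vᵀ) := by
  have hVV : V * Vᵀ * (V * Vᵀ) = V * Vᵀ := by
    rw [Matrix.mul_assoc, ← Matrix.mul_assoc Vᵀ, hV, Matrix.one_mul]
  have hZ : Z * (V * Vᵀ) * (V * Vᵀ) = Z * (V * Vᵀ) := by rw [Matrix.mul_assoc, hVV]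
  rw [tangentProj_apply, Matrix.mul_assoc (U * Uᵀ) (Z * (V * Vᵀ)) (V * Vᵀ), hZ]
  abel

/-- "so that `Z V Vᵀ ∈ T_Y M_r`" (indeed `Z V Vᵀ = (Z V) Vᵀ` is of the form `Ġ Vᵀ`, at any `U`,
`V`).  [cite: LubichOseledets2013, §3.1 Lemma 3.1 (proof)] -/
theorem mul_projRight_mem_tangentSpace [Fintype n] (U : Matrix m r F) (V : Matrix n r F) (Z : Matrix m n F) :
    Z * (V * Vᵀ) ∈ tangentSpace U V :=
  mem_tangentSpace_iff.2 ⟨Z * V, 0, by rw [transpose_zero, Matrix.mul_zero, add_zero,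
    Matrix.mul_assoc]⟩

/-- "Similarly we also have `U Uᵀ Z ∈ T_Y M_r`" (`U Uᵀ Z = U (Zᵀ U)ᵀ` is of the form `U Ḣᵀ`).
[cite: LubichOseledets2013, §3.1 Lemma 3.1 (proof)] -/
theorem projLeft_mul_mem_tangentSpace [Fintype m] (U : Matrix m r F) (V : Matrix n r F) (Z : Matrix m n F) :
    U * Uᵀ * Z ∈ tangentSpace U V :=
  mem_tangentSpace_iff.2 ⟨0, Zᵀ * U, by rw [Matrix.zero_mul, zero_add, transpose_mul,
    transpose_transpose, Matrix.mul_assoc]⟩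

/-- "… and `U Uᵀ Z V Vᵀ ∈ T_Y M_r`".  [cite: LubichOseledets2013, §3.1 Lemma 3.1 (proof)] -/
theorem projLeft_mul_mul_projRight_mem_tangentSpace [Fintype m] [Fintype n] (U : Matrix m r F) (V : Matrix n r F)
    (Z : Matrix m n F) : U * Uᵀ * Z * (V * Vᵀ) ∈ tangentSpace U V :=
  mem_tangentSpace_iff.2 ⟨U * Uᵀ * Z * V, 0, by rw [transpose_zero, Matrix.mul_zero, add_zero,
    Matrix.mul_assoc (U * Uᵀ * Z)]⟩

/-- With `Uᵀ U = I` likewise `P(Y)(U Uᵀ Z) = U Uᵀ Z` (the third substep's right-hand side is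
fixed by the projector).  [cite: LubichOseledets2013, §3.1 Lemma 3.1 (proof)] -/
theorem tangentProj_projLeft_mul [Fintype m] [Fintype n] [DecidableEq r] {U : Matrix m r F} (hU : Uᵀ * U = 1)
    (V : Matrix n r F) (Z : Matrix m n F) :
    tangentProj U V (U * Uᵀ * Z) = U * Uᵀ * Z := by
  have hUU : U * Uᵀ * (U * Uᵀ) = U * Uᵀ := by
    rw [Matrix.mul_assoc, ← Matrix.mul_assoc Uᵀ, hU, Matrix.one_mul]
  rw [tangentProj_apply, ← Matrix.mul_assoc (U * Uᵀ) (U * Uᵀ) Z, hUU]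
  abel

/-! ## §2. The practical first-order splitting algorithm (`K`-step, `S`-step, `L`-step) -/

/-- THE `K`-STEP: "Set `K_1 = U_0 S_0 + ΔA V_0` and compute the factorization `U_1 Ŝ_1 = K_1` with
`U_1` having orthonormal columns and an `r × r` matrix `Ŝ_1` (using QR or SVD)."
[cite: LubichOseledets2013, §3.2] -/
def kStep [Fintype n] (U₀ : Matrix m r F) (S₀ : Matrix r r F) (V₀ : Matrix n r F) (ΔA : Matrix m n F) :
    Matrix m r F :=
  U₀ * S₀ + ΔA * V₀

omit [Fintype r] in
/-- THE `S`-STEP: "Set `S̃_0 = Ŝ_1 - U_1ᵀ ΔA V_0`."  [cite: LubichOseledets2013, §3.2] -/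
def sStep [Fintype m] [Fintype n] (S₁h : Matrix r r F) (U₁ : Matrix m r F) (ΔA : Matrix m n F) (V₀ : Matrix n r F) :
    Matrix r r F :=
  S₁h - U₁ᵀ * ΔA * V₀

/-- THE `L`-STEP: "Set `L_1 = V_0 S̃_0ᵀ + ΔAᵀ U_1` and compute the factorization `V_1 S_1ᵀ = L_1`,
with `V_1` having orthonormal columns and an `r × r` matrix `S_1` (using QR or SVD).  The algorithm
computes a factorization of the rank-`r` matrix `Y_1 = U_1 S_1 V_1ᵀ`, which is taken as an
approximation to `Y(t_1)`."  [cite: LubichOseledets2013, §3.2] -/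
def lStep [Fintype m] (V₀ : Matrix n r F) (S₀t : Matrix r r F) (ΔA : Matrix m n F) (U₁ : Matrix m r F) :
    Matrix n r F :=
  V₀ * S₀tᵀ + ΔAᵀ * U₁

/-- `K_1 = U_0 S_0 + ΔA V_0`.  [cite: LubichOseledets2013, §3.2] -/
theorem kStep_eq [Fintype n] (U₀ : Matrix m r F) (S₀ : Matrix r r F) (V₀ : Matrix n r F) (ΔA : Matrix m n F) :
    kStep U₀ S₀ V₀ ΔA = U₀ * S₀ + ΔA * V₀ := rfl

omit [Fintype r] in
/-- `S̃_0 = Ŝ_1 - U_1ᵀ ΔA V_0`.  [cite: LubichOseledets2013, §3.2] -/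
theorem sStep_eq [Fintype m] [Fintype n] (S₁h : Matrix r r F) (U₁ : Matrix m r F) (ΔA : Matrix m n F) (V₀ : Matrix n r F) :
    sStep S₁h U₁ ΔA V₀ = S₁h - U₁ᵀ * ΔA * V₀ := rfl

/-- `L_1 = V_0 S̃_0ᵀ + ΔAᵀ U_1`.  [cite: LubichOseledets2013, §3.2] -/
theorem lStep_eq [Fintype m] (V₀ : Matrix n r F) (S₀t : Matrix r r F) (ΔA : Matrix m n F) (U₁ : Matrix m r F) :
    lStep V₀ S₀t ΔA U₁ = V₀ * S₀tᵀ + ΔAᵀ * U₁ := rfl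

/-- "Note that there is no matrix inversion in the algorithm": with the exact data `Y_0 = A(t_0)`
in factored form `U_0 S_0 V_0ᵀ` with `V_0ᵀ V_0 = I`, the `K`-step reads `K_1 = A(t_1) V_0`
("The first substep of the algorithm, starting from `Y_0 = U_0 S_0 V_0ᵀ = A(t_0)`, yields
`U_1 Ŝ_1 = A(t_1) V_0`").  [cite: LubichOseledets2013, §4 Thm 4.1 (proof)] -/
theorem kStep_eq_mul_of_start [Fintype n] [DecidableEq r] {U₀ : Matrix m r F} {S₀ : Matrix r r F}
    {V₀ : Matrix n r F} {A₀ : Matrix m n F} (hY₀ : U₀ * S₀ * V₀ᵀ = A₀) (hV₀ : V₀ᵀ * V₀ = 1)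
    (A₁ : Matrix m n F) : kStep U₀ S₀ V₀ (A₁ - A₀) = A₁ * V₀ := by
  have h : A₀ * V₀ = U₀ * S₀ := by rw [← hY₀, Matrix.mul_assoc, hV₀, Matrix.mul_one]
  rw [kStep, Matrix.sub_mul, h]
  abel

/-- THE RESULT OF ONE STEP, FIRST LINE OF THE COMPUTATION: from the `L`-step factorization
`V_1 S_1ᵀ = L_1` alone, `Y_1 = U_1 S_1 V_1ᵀ = U_1 L_1ᵀ = U_1 S̃_0 V_0ᵀ + U_1 U_1ᵀ ΔA`.
[cite: LubichOseledets2013, §4 Thm 4.1 (proof)] -/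
theorem result_eq_of_lFac [Fintype m] {V₀ V₁ : Matrix n r F} {S₀t S₁ : Matrix r r F} {ΔA : Matrix m n F}
    {U₁ : Matrix m r F} (hL : V₁ * S₁ᵀ = lStep V₀ S₀t ΔA U₁) :
    U₁ * S₁ * V₁ᵀ = U₁ * S₀t * V₀ᵀ + U₁ * U₁ᵀ * ΔA := by
  have h : S₁ * V₁ᵀ = (V₁ * S₁ᵀ)ᵀ := by rw [transpose_mul, transpose_transpose]
  rw [Matrix.mul_assoc, h, hL, lStep, transpose_add, transpose_mul, transpose_mul,
    transpose_transpose, transpose_transpose, Matrix.mul_add, Matrix.mul_assoc, Matrix.mul_assoc]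

/-- THE RESULT OF ONE STEP, EXPANDED: with both factorizations,
`Y_1 = U_1 Ŝ_1 V_0ᵀ - U_1 U_1ᵀ ΔA V_0 V_0ᵀ + U_1 U_1ᵀ ΔA
     = U_0 S_0 V_0ᵀ + ΔA V_0 V_0ᵀ - U_1 U_1ᵀ ΔA V_0 V_0ᵀ + U_1 U_1ᵀ ΔA`
(lines 3–4 of the computation in the proof of Theorem 4.1; no orthonormality is used yet).
[cite: LubichOseledets2013, §4 Thm 4.1 (proof)] -/
theorem result_eq_expand [Fintype m] [Fintype n] {U₀ U₁ : Matrix m r F} {S₀ S₁h S₁ : Matrix r r F} {V₀ V₁ : Matrix n r F}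
    {ΔA : Matrix m n F} (hK : U₁ * S₁h = kStep U₀ S₀ V₀ ΔA)
    (hL : V₁ * S₁ᵀ = lStep V₀ (sStep S₁h U₁ ΔA V₀) ΔA U₁) :
    U₁ * S₁ * V₁ᵀ =
      U₀ * S₀ * V₀ᵀ + ΔA * V₀ * V₀ᵀ - U₁ * U₁ᵀ * ΔA * V₀ * V₀ᵀ + U₁ * U₁ᵀ * ΔA := by
  rw [result_eq_of_lFac hL, sStep, Matrix.mul_sub, Matrix.sub_mul, hK, kStep, Matrix.add_mul,
    ← Matrix.mul_assoc, ← Matrix.mul_assoc]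

/-! ## §3. The exactness property (Theorem 4.1) -/

/-- "… and hence we have … as well as `A_0 V_0 V_0ᵀ = A_0`" (for `A_0 = U_0 S_0 V_0ᵀ` with
`V_0ᵀ V_0 = I`).  [cite: LubichOseledets2013, §4 Thm 4.1 (proof)] -/
theorem start_mul_projRight [Fintype n] [DecidableEq r] {U₀ : Matrix m r F} {S₀ : Matrix r r F}
    {V₀ : Matrix n r F} {A₀ : Matrix m n F} (hY₀ : U₀ * S₀ * V₀ᵀ = A₀) (hV₀ : V₀ᵀ * V₀ = 1) :
    A₀ * V₀ * V₀ᵀ = A₀ := by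
  rw [← hY₀, Matrix.mul_assoc (U₀ * S₀), hV₀, Matrix.mul_one]

/-- THE RESULT OF ONE STEP FROM EXACT DATA: if `Y_0 = U_0 S_0 V_0ᵀ = A_0` with `V_0ᵀ V_0 = I` and
the `K`-step factor has `U_1ᵀ U_1 = I`, then the computation of the proof of Theorem 4.1 gives,
before its final substitution `U_1 U_1ᵀ A_1 = A_1`, the identity `Y_1 = U_1 U_1ᵀ A_1`
(`ΔA = A_1 - A_0`; so the step is exact precisely when the range of `A_1` lies in that of `U_1`).
[cite: LubichOseledets2013, §4 Thm 4.1 (proof)] -/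
theorem result_eq_projLeft_mul [Fintype m] [Fintype n] [DecidableEq r] {U₀ U₁ : Matrix m r F} {S₀ S₁h S₁ : Matrix r r F}
    {V₀ V₁ : Matrix n r F} {A₀ A₁ : Matrix m n F} (hY₀ : U₀ * S₀ * V₀ᵀ = A₀) (hV₀ : V₀ᵀ * V₀ = 1)
    (hU₁ : U₁ᵀ * U₁ = 1) (hK : U₁ * S₁h = kStep U₀ S₀ V₀ (A₁ - A₀))
    (hL : V₁ * S₁ᵀ = lStep V₀ (sStep S₁h U₁ (A₁ - A₀) V₀) (A₁ - A₀) U₁) :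
    U₁ * S₁ * V₁ᵀ = U₁ * U₁ᵀ * A₁ := by
  have hK' : U₁ * S₁h = A₁ * V₀ := by rw [hK, kStep_eq_mul_of_start hY₀ hV₀]
  -- `U_1 U_1ᵀ (A_1 V_0) = U_1 U_1ᵀ U_1 Ŝ_1 = U_1 Ŝ_1 = A_1 V_0`
  have hP : U₁ * U₁ᵀ * (A₁ * V₀) = A₁ * V₀ := by
    rw [← hK', ← Matrix.mul_assoc, Matrix.mul_assoc U₁ U₁ᵀ U₁, hU₁, Matrix.mul_one]
  have hA₀ := start_mul_projRight hY₀ hV₀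
  have e1 : U₁ * (U₁ᵀ * (A₁ - A₀) * V₀) * V₀ᵀ =
      U₁ * U₁ᵀ * (A₁ * V₀) * V₀ᵀ - U₁ * U₁ᵀ * (A₀ * V₀ * V₀ᵀ) := by
    simp only [Matrix.mul_sub, Matrix.sub_mul, Matrix.mul_assoc]
  have e2 : U₁ * U₁ᵀ * (A₁ - A₀) = U₁ * U₁ᵀ * A₁ - U₁ * U₁ᵀ * A₀ := Matrix.mul_sub _ _ _
  rw [result_eq_of_lFac hL, sStep, Matrix.mul_sub, Matrix.sub_mul, hK', e1, e2, hP, hA₀]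
  abel

/-- "so that the range of `A_1 = A(t_1) = (U(t_1) S(t_1)) V(t_1)ᵀ = U_1 Ŝ_1 (V(t_1)ᵀ V(t_0))⁻¹ V(t_1)ᵀ`
is contained in the range of `U_1`, and hence we have `U_1 U_1ᵀ A_1 = A_1`."  We derive it from the
`K`-step factorization `U_1 Ŝ_1 = A_1 V_0` (`U_1ᵀ U_1 = I`) under the intrinsic form of the
paper's standing assumption "`V(t_1)ᵀ V(t_0)` is invertible", namely `rank (A_1 V_0) = rank A_1`
(see `rank_mul_eq_rank_of_isUnit_det`).  [cite: LubichOseledets2013, §4 Thm 4.1 (proof)] -/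
theorem projLeft_mul_eq_self_of_rank_eq [Fintype m] [Fintype n] [DecidableEq n] [DecidableEq r]
    {U₁ : Matrix m r F} {S₁h : Matrix r r F} {V₀ : Matrix n r F} {A₁ : Matrix m n F}
    (hU₁ : U₁ᵀ * U₁ = 1) (hK : U₁ * S₁h = A₁ * V₀) (hrk : (A₁ * V₀).rank = A₁.rank) :
    U₁ * U₁ᵀ * A₁ = A₁ := by
  -- the range of `A_1 V_0` is contained in the range of `A_1` and has the same dimension
  have hle : LinearMap.range (A₁ * V₀).mulVecLin ≤ LinearMap.range A₁.mulVecLin := by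
    rw [Matrix.mulVecLin_mul]
    exact LinearMap.range_comp_le_range _ _
  have heq : LinearMap.range (A₁ * V₀).mulVecLin = LinearMap.range A₁.mulVecLin :=
    Submodule.eq_of_le_of_finrank_eq hle hrk
  -- hence every `A_1 x` is some `U_1 y`, on which `U_1 U_1ᵀ` acts as the identity
  have hfix : ∀ x : n → F, (U₁ * U₁ᵀ * A₁) *ᵥ x = A₁ *ᵥ x := by
    intro x
    have hx : A₁ *ᵥ x ∈ LinearMap.range (A₁ * V₀).mulVecLin := heq ▸ ⟨x, rfl⟩
    obtain ⟨z, hz⟩ := hx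
    have hz' : A₁ *ᵥ x = U₁ *ᵥ (S₁h *ᵥ z) := by
      rw [← hz, Matrix.mulVecLin_apply, ← hK, Matrix.mulVec_mulVec]
    rw [← Matrix.mulVec_mulVec, hz', Matrix.mulVec_mulVec (S₁h *ᵥ z) (U₁ * U₁ᵀ) U₁,
      Matrix.mul_assoc U₁ U₁ᵀ U₁, hU₁, Matrix.mul_one]
  ext i j
  have := congrFun (hfix (Pi.single j 1)) i
  rw [Matrix.mulVec_single_one, Matrix.mulVec_single_one] at this
  exact this

/-- The paper's assumption implies the rank condition: if `A_1 = U S Vᵀ` with `Vᵀ V = I` and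
`Vᵀ V_0` invertible ("We assume that `V(t_1)ᵀ V(t_0)` is invertible.  If this is not satisfied,
then we make the following argument with a small perturbation of `A(t_1)` …"), then
`rank (A_1 V_0) = rank A_1`.  [cite: LubichOseledets2013, §4 Thm 4.1 (proof)] -/
theorem rank_mul_eq_rank_of_isUnit_det [Fintype n] [DecidableEq r] (U : Matrix m r F) (S : Matrix r r F)
    {V V₀ : Matrix n r F} (hV : Vᵀ * V = 1) (hVV₀ : IsUnit (Vᵀ * V₀).det) :
    (U * S * Vᵀ * V₀).rank = (U * S * Vᵀ).rank := by
  rw [Matrix.mul_assoc (U * S), Matrix.rank_mul_eq_left_of_isUnit_det _ _ hVV₀]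
  refine le_antisymm ?_ (Matrix.rank_mul_le_left _ _)
  calc (U * S).rank = (U * S * Vᵀ * V).rank := by
        rw [Matrix.mul_assoc (U * S), hV, Matrix.mul_one]
    _ ≤ (U * S * Vᵀ).rank := Matrix.rank_mul_le_left _ _

/-- THEOREM 4.1 (EXACTNESS OF THE SPLITTING INTEGRATOR).  "Suppose that `A(t)` has rank at most
`r` for all `t`.  With the initial value `Y_0 = A(t_0)`, the splitting algorithm of Section 3.2 is
then exact: `Y_1 = A(t_1)`."  Formally: if `A_0 = U_0 S_0 V_0ᵀ` with `V_0ᵀ V_0 = I` (the exact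
rank-`≤ r` starting value in factored form), `ΔA = A_1 - A_0`, `U_1 Ŝ_1 = K_1` with
`U_1ᵀ U_1 = I`, `S̃_0` and `L_1` as in §3.2 and `V_1 S_1ᵀ = L_1` (any factorization), then under
the paper's standing genericity assumption in the form `rank (A_1 V_0) = rank A_1` the computed
`Y_1 = U_1 S_1 V_1ᵀ` equals `A_1`:
"`Y_1 = U_1 S_1 V_1ᵀ = U_1 S̃_0 V_0ᵀ + U_1 U_1ᵀ ΔA = U_1 Ŝ_1 V_0ᵀ - U_1 U_1ᵀ ΔA V_0 V_0ᵀ + U_1 U_1ᵀ ΔA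
 = U_0 S_0 V_0ᵀ + ΔA V_0 V_0ᵀ - U_1 U_1ᵀ ΔA V_0 V_0ᵀ + U_1 U_1ᵀ ΔA
 = A_0 + A_1 V_0 V_0ᵀ - A_0 - A_1 V_0 V_0ᵀ + U_1 U_1ᵀ A_0 + A_1 - U_1 U_1ᵀ A_0 = A_1`."
[cite: LubichOseledets2013, §4 Thm 4.1] -/
theorem exactness [Fintype m] [Fintype n] [DecidableEq n] [DecidableEq r] {U₀ U₁ : Matrix m r F}
    {S₀ S₁h S₁ : Matrix r r F} {V₀ V₁ : Matrix n r F} {A₀ A₁ : Matrix m n F}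
    (hY₀ : U₀ * S₀ * V₀ᵀ = A₀) (hV₀ : V₀ᵀ * V₀ = 1) (hU₁ : U₁ᵀ * U₁ = 1)
    (hK : U₁ * S₁h = kStep U₀ S₀ V₀ (A₁ - A₀))
    (hL : V₁ * S₁ᵀ = lStep V₀ (sStep S₁h U₁ (A₁ - A₀) V₀) (A₁ - A₀) U₁)
    (hrk : (A₁ * V₀).rank = A₁.rank) :
    U₁ * S₁ * V₁ᵀ = A₁ := by
  rw [result_eq_projLeft_mul hY₀ hV₀ hU₁ hK hL]
  exact projLeft_mul_eq_self_of_rank_eq hU₁ (by rw [hK, kStep_eq_mul_of_start hY₀ hV₀]) hrk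

/-- THEOREM 4.1 with the genericity assumption in the paper's own form: `A_1 = U S Vᵀ` with
`Vᵀ V = I` and `Vᵀ V_0` invertible.  [cite: LubichOseledets2013, §4 Thm 4.1] -/
theorem exactness_of_isUnit_det [Fintype m] [Fintype n] [DecidableEq n] [DecidableEq r]
    {U₀ U₁ U : Matrix m r F} {S₀ S₁h S₁ S : Matrix r r F} {V₀ V₁ V : Matrix n r F}
    {A₀ A₁ : Matrix m n F} (hY₀ : U₀ * S₀ * V₀ᵀ = A₀) (hV₀ : V₀ᵀ * V₀ = 1)
    (hA₁ : U * S * Vᵀ = A₁) (hV : Vᵀ * V = 1) (hVV₀ : IsUnit (Vᵀ * V₀).det)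
    (hU₁ : U₁ᵀ * U₁ = 1) (hK : U₁ * S₁h = kStep U₀ S₀ V₀ (A₁ - A₀))
    (hL : V₁ * S₁ᵀ = lStep V₀ (sStep S₁h U₁ (A₁ - A₀) V₀) (A₁ - A₀) U₁) :
    U₁ * S₁ * V₁ᵀ = A₁ :=
  exactness hY₀ hV₀ hU₁ hK hL (by
    rw [← hA₁]
    exact rank_mul_eq_rank_of_isUnit_det U S hV hVV₀)

/-- EXACTNESS, RANGE FORM: the computed `Y_1` is a tangent-space object at the new point — it is
exact as soon as `U_1 U_1ᵀ A_1 = A_1` (the range of `A_1` lies in the range of `U_1`), with no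
rank hypothesis.  [cite: LubichOseledets2013, §4 Thm 4.1 (proof)] -/
theorem exactness_of_projLeft_mul_eq [Fintype m] [Fintype n] [DecidableEq r] {U₀ U₁ : Matrix m r F}
    {S₀ S₁h S₁ : Matrix r r F} {V₀ V₁ : Matrix n r F} {A₀ A₁ : Matrix m n F}
    (hY₀ : U₀ * S₀ * V₀ᵀ = A₀) (hV₀ : V₀ᵀ * V₀ = 1) (hU₁ : U₁ᵀ * U₁ = 1)
    (hK : U₁ * S₁h = kStep U₀ S₀ V₀ (A₁ - A₀))
    (hL : V₁ * S₁ᵀ = lStep V₀ (sStep S₁h U₁ (A₁ - A₀) V₀) (A₁ - A₀) U₁)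
    (hrange : U₁ * U₁ᵀ * A₁ = A₁) : U₁ * S₁ * V₁ᵀ = A₁ := by
  rw [result_eq_projLeft_mul hY₀ hV₀ hU₁ hK hL, hrange]

end ProjectorSplitting

end Literature.LinearAlgebra.Matrix
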